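import Literature.Computability.Complexity.NondeterministicKannan
import Literature.Computability.Complexity.FPStringBricks
import HarnessLib

/-!
# The diagonal language `NKannan.nlang` as five nested bounded quantifiers over polynomial-time matrices

`Literature/Computability/Complexity`, companion of `NondeterministicKannan.lean`. The named fact
`NKannan.nlang_mem_DTIME_exp_exp` (`nlang ∈ DTIME(2^{2^{cn}})`, the last leaf under the barrier fact
`Literature.Barriers.PneNP.MCSPKarpHardness`) is an exhaustive search; this file isolates its
*logical* half, so that the machine half reduces to one generic statement about bounded
quantifiers. We define

* `BEX k β A = {w | ∃ y ∈ {0,1}^{β n}, ⟨w, y⟩ ∈ A}` and `BALL k β A` (dually), where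
  `n = |fstP^[k] w|` is the length of the core input `k` pair-levels deep
  (`BALL_eq_compl_BEX_compl`);
* the front-padding code of "all strings of length `≤ m`" by strings of length `m + 1`, with its
  decoder `decode` (a two-state transducer `decodeT`, hence `decode ∈ FP`; `decode_code`,
  `length_decode_le`);
* the five levels of `nlang`: the matrix `L0` (the evaluator accepts `⟨y v, decode D'⟩`),
  `NACC k = ∃v·L0` (nondeterministic acceptance), `BIT`, `NEQV` (their disagreement), `EXY k = ∃y·NEQV`,
  `HARD k = ∀D'·EXY` (hardness of the last component), `LT`, `MINL = ∀T'·(LTᶜ ⊔ (HARD 2)ᶜ)`,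
  `TOPBIT`, `TOP = HARD 1 ⊓ MINL ⊓ TOPBIT`;

and prove

* the semantics of each level on well-formed tuples (`mem_NACC_iff`, …, `mem_HARD_one_iff :
  ⟨x, T⟩ ∈ HARD 1 ↔ IsNHard |x| T`, `mem_MINL_iff`) and **`nlang_eq_BEX_TOP : nlang = ∃T·TOP`**
  (quantifier ranges, outside in: `|T| = 2ⁿ`, `|T'| = 2ⁿ`, `|D'| = m(n) + 1`, `|y| = n`,
  `|v| = ℓ(n)`, all functions of the core length `n = |x|`);
* the matrices are polynomial-time tests: `L0_mem_P`, `BIT_mem_P`, `TOPBIT_mem_P`, `LT_mem_P`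
  (and the reusable `setOf_getD_bitsToNat_mem_P`: bit tests at a binary address are in `P`).

What remains for `nlang_mem_DTIME_exp_exp` is thus exactly: `BEX k β` / `BALL k β` map languages
decidable in time `t` to languages decidable in time `≈ 2^{β n} · t`, for the range functions
`β ∈ {n ↦ 2ⁿ, m(n) + 1, n, ℓ(n)}` (machines: an enumerator of `{0,1}^{β n}` feeding the decider, e.g.
`TM2AnyList.lean`'s `anyMachine`, or the clocked loop of `TM2IterateBound.lean`), plus the closure of
such time classes under the Boolean combinations with `P`-tests used in `NEQV`, `MINL`, `TOP`.

## References

* R. Kannan, *Circuit-size lower bounds and non-reducibility to sparse sets*, Inform. Control 55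
  (1982), proof of Lemma 1 (the `Σ₄` quantifier structure "∃ C* ∀ C' ∃ y … ∀ C < C* ∃ C₀ ∀ z").
* S. Arora, B. Barak, *Computational Complexity: A Modern Approach*, CUP 2009, §1.3, Thm. 6.18.
-/

namespace Literature.Computability.Complexity

namespace NKannan

open Kannan CircEval

/-! ### Bounded quantifiers over strings of a prescribed length -/

/-- **Bounded existential quantifier**: `w ∈ BEX k β A` iff `⟨w, y⟩ ∈ A` for some `y` of length
exactly `β n`, where `n = |fstP^[k] w|` is the length of the core input sitting `k` pair-levels
deep. [folklore] -/
def BEX (k : ℕ) (β : ℕ → ℕ) (A : Language Bool) : Language Bool :=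
  {w | ∃ y : List Bool, y.length = β (fstP^[k] w).length ∧ boolPair w y ∈ A}

/-- **Bounded universal quantifier**, dually. [folklore] -/
def BALL (k : ℕ) (β : ℕ → ℕ) (A : Language Bool) : Language Bool :=
  {w | ∀ y : List Bool, y.length = β (fstP^[k] w).length → boolPair w y ∈ A}

/-- Unfolding `BEX`. [folklore] -/
theorem mem_BEX {k : ℕ} {β : ℕ → ℕ} {A : Language Bool} {w : List Bool} :
    w ∈ BEX k β A ↔ ∃ y : List Bool, y.length = β (fstP^[k] w).length ∧ boolPair w y ∈ A := Iff.rfl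

/-- Unfolding `BALL`. [folklore] -/
theorem mem_BALL {k : ℕ} {β : ℕ → ℕ} {A : Language Bool} {w : List Bool} :
    w ∈ BALL k β A ↔ ∀ y : List Bool, y.length = β (fstP^[k] w).length → boolPair w y ∈ A := Iff.rfl

/-- Membership in a complement of a language. [folklore] -/
theorem mem_compl_iff' (K : Language Bool) (w : List Bool) : w ∈ Kᶜ ↔ w ∉ K := Iff.rfl

/-- Membership in a meet of languages. [folklore] -/
theorem mem_inf_iff' (K K' : Language Bool) (w : List Bool) : w ∈ K ⊓ K' ↔ w ∈ K ∧ w ∈ K' := Iff.rfl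

/-- Membership in a join of languages. [folklore] -/
theorem mem_sup_iff' (K K' : Language Bool) (w : List Bool) : w ∈ K ⊔ K' ↔ w ∈ K ∨ w ∈ K' := Iff.rfl

/-- `BALL` is the complement of `BEX` of the complement. [folklore] -/
theorem BALL_eq_compl_BEX_compl (k : ℕ) (β : ℕ → ℕ) (A : Language Bool) :
    BALL k β A = (BEX k β Aᶜ)ᶜ := by
  ext w
  rw [mem_compl_iff', mem_BEX, mem_BALL]
  simp only [mem_compl_iff', not_exists, not_and, not_not]

/-- The core one level up: `fstP^[k+1] ⟨w, y⟩ = fstP^[k] w`. [folklore] -/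
@[simp] theorem iterate_fstP_boolPair (k : ℕ) (w y : List Bool) :
    fstP^[k + 1] (boolPair w y) = fstP^[k] w := by
  rw [Function.iterate_succ_apply, fstP_boolPair]

/-! ### Padding codes for "all strings of length `≤ m`", decoded by a transducer -/

/-- Decoding of the (front-)padding code `0^{m-|D|} 1 D` of a string `D` of length `≤ m` into a
string of length exactly `m + 1` (cf. `Kannan.code`, which pads at the end): drop the leading
zeros and the first `1`. Total: a word without a `1` decodes to `[]`. [folklore] -/
def decode (w : List Bool) : List Bool :=
  (w.dropWhile fun b => b == false).drop 1

/-- `decode` inverts the padding code. [folklore] -/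
theorem decode_code (k : ℕ) (D : List Bool) :
    decode (List.replicate k false ++ true :: D) = D := by
  rw [decode, List.dropWhile_append, if_pos (by simp)]
  simp

/-- A decoded word is shorter: `|decode w| ≤ |w| - 1`. [folklore] -/
theorem length_decode_le (w : List Bool) : (decode w).length ≤ w.length - 1 := by
  simp only [decode, List.length_drop]
  have := (List.dropWhile_suffix (p := fun b => b == false) (l := w)).length_le
  omega

/-- The decoder as a two-state transducer (state `false`: skipping zeros; `true`: copying). [folklore] -/
def decodeT : FST Bool Bool Bool where
  init := false
  step := fun s b => if s then (true, [b]) else if b then (true, []) else (false, [])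
  front := fun _ => []
  keep := fun _ => true

/-- In the copying state the transducer copies. [folklore] -/
theorem decodeT_run_true (l : List Bool) : decodeT.run true l = (true, l) := by
  induction l with
  | nil => rfl
  | cons b l ih => simp [FST.run_cons, decodeT, ih] at *

/-- The transducer computes `decode`. [folklore] -/
theorem decodeT_eval (w : List Bool) : decodeT.eval w = decode w := by
  induction w with
  | nil => rfl
  | cons b w ih =>
    cases b
    · simpa [FST.eval, decodeT, decode] using ih
    · have h := decodeT_run_true w
      simp only [decodeT] at h
      simp [FST.eval, decodeT, decode, h]

/-- `decode ∈ FP`. [folklore] -/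
theorem decode_mem_FP : decode ∈ FP := by
  have h : decode = decodeT.eval := funext fun w => (decodeT_eval w).symm
  rw [h]
  exact decodeT.polyTimeComputable_eval

/-! ### The matrix and the five levels -/

/-- **Level 0 (the matrix)**: words `⟨⟨⟨⟨x, T⟩, D'⟩, y⟩, v⟩`; accept iff the description decoded
from `D'` accepts `y v` (`Kannan.descAccepts`, i.e. `CircEval.evalFn ⟨y v, D⟩ = [1]`). [folklore] -/
def L0 : Language Bool :=
  {w | descAccepts (decode (sndP (fstP (fstP w)))) (sndP (fstP w) ++ sndP w) = true}

/-- **Nondeterministic acceptance level** (`∃ v`): words `⟨⟨⟨x, T⟩, D'⟩, y⟩` with the core `x`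
at depth `k + 2`. [folklore] -/
def NACC (k : ℕ) : Language Bool := BEX (k + 2) wit L0

/-- The table bit: words `⟨⟨⟨x, T⟩, D'⟩, y⟩`, accept iff `T[⟦y⟧] = 1`. [folklore] -/
def BIT : Language Bool :=
  {w | (sndP (fstP (fstP w))).getD (bitsToNat (sndP w)) false = true}

/-- Disagreement of the description with the table at `y`: `¬ (NACC ↔ BIT)`, as a Boolean
combination. [folklore] -/
def NEQV (k : ℕ) : Language Bool := (NACC k ⊓ BITᶜ) ⊔ ((NACC k)ᶜ ⊓ BIT)

/-- **`∃ y` level**: words `⟨⟨x, T⟩, D'⟩`, some address `y ∈ {0,1}ⁿ` witnesses disagreement. [folklore] -/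
def EXY (k : ℕ) : Language Bool := BEX (k + 1) (fun n => n) (NEQV k)

/-- **Hardness level** (`∀ D`): words `W = ⟨…, T⟩` whose last component `T` is hard at length
`n = |fstP^[k] W|`, the descriptions being ranged over through their padding codes
`D' ∈ {0,1}^{m(n)+1}`. [folklore] -/
def HARD (k : ℕ) : Language Bool := BALL k (fun n => budget n + 1) (EXY k)

/-- Comparison of the two tables of `⟨⟨x, T⟩, T'⟩`: `⟦T'⟧ < ⟦T⟧`. [folklore] -/
def LT : Language Bool := {u | bitsToNat (sndP u) < bitsToNat (sndP (fstP u))}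

/-- **Minimality level** (`∀ T'`): words `⟨x, T⟩` such that no table `T'` of length `2ⁿ` with
smaller value is hard. [folklore] -/
def MINL : Language Bool := BALL 1 (fun n => 2 ^ n) (LTᶜ ⊔ (HARD 2)ᶜ)

/-- The top bit: words `⟨x, T⟩`, accept iff `T[⟦x⟧] = 1`. [folklore] -/
def TOPBIT : Language Bool := {w | (sndP w).getD (bitsToNat (fstP w)) false = true}

/-- **Top level** (`∃ T`): `⟨x, T⟩` with `T` the least hard table and `T[⟦x⟧] = 1`. [folklore] -/
def TOP : Language Bool := HARD 1 ⊓ MINL ⊓ TOPBIT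

/-! ### Semantics of the levels -/

/-- Semantics of `L0`. [folklore] -/
theorem mem_L0_iff (W D' y v : List Bool) :
    boolPair (boolPair (boolPair W D') y) v ∈ L0 ↔ descAccepts (decode D') (y ++ v) = true := by
  change descAccepts (decode (sndP (fstP (fstP _)))) (sndP (fstP _) ++ sndP _) = true ↔ _
  simp only [fstP_boolPair, sndP_boolPair]

/-- Semantics of `NACC`: on `⟨⟨W, D'⟩, y⟩` with `|fstP^[k] W| = n` it is nondeterministic acceptance
of `y` by the decoded description. [folklore] -/
theorem mem_NACC_iff {k : ℕ} (W D' y : List Bool) :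
    boolPair (boolPair W D') y ∈ NACC k ↔ NAccepts (fstP^[k] W).length (decode D') y := by
  rw [NACC, mem_BEX, NAccepts, iterate_fstP_boolPair, iterate_fstP_boolPair]
  exact exists_congr fun v => and_congr_right fun _ => mem_L0_iff W D' y v

/-- Semantics of `BIT`. [folklore] -/
theorem mem_BIT_iff (x T D' y : List Bool) :
    boolPair (boolPair (boolPair x T) D') y ∈ BIT ↔ T.getD (bitsToNat y) false = true := by
  change (sndP (fstP (fstP _))).getD (bitsToNat (sndP _)) false = true ↔ _
  simp only [fstP_boolPair, sndP_boolPair]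

/-- Semantics of `NEQV`. [folklore] -/
theorem mem_NEQV_iff {k : ℕ} (x T D' y : List Bool) :
    boolPair (boolPair (boolPair x T) D') y ∈ NEQV k ↔
      ¬ (NAccepts (fstP^[k] (boolPair x T)).length (decode D') y ↔ T.getD (bitsToNat y) false = true) := by
  rw [NEQV, mem_sup_iff', mem_inf_iff', mem_inf_iff', mem_compl_iff', mem_compl_iff',
    mem_NACC_iff, mem_BIT_iff]
  tauto

/-- Semantics of `EXY`. [folklore] -/
theorem mem_EXY_iff {k : ℕ} (x T D' : List Bool) :
    boolPair (boolPair x T) D' ∈ EXY k ↔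
      ∃ y : List Bool, y.length = (fstP^[k] (boolPair x T)).length ∧
        ¬ (NAccepts (fstP^[k] (boolPair x T)).length (decode D') y ↔ T.getD (bitsToNat y) false = true) := by
  rw [EXY, mem_BEX, iterate_fstP_boolPair]
  exact exists_congr fun y => and_congr_right fun _ => mem_NEQV_iff x T D' y

/-- **Semantics of `HARD`**: on `⟨x, T⟩`-shaped words, `HARD k` is hardness of the last component at
the core length (without the length clause of `IsNHard`). Descriptions of length `≤ m(n)` and
padding codes of length `m(n) + 1` range over the same decoded values (`decode_code`,
`length_decode_le`). [folklore] -/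
theorem mem_HARD_iff {k : ℕ} (x T : List Bool) :
    boolPair x T ∈ HARD k ↔ ∀ D : List Bool, D.length ≤ budget (fstP^[k] (boolPair x T)).length →
      ∃ y : List Bool, y.length = (fstP^[k] (boolPair x T)).length ∧
        ¬ (NAccepts (fstP^[k] (boolPair x T)).length D y ↔ T.getD (bitsToNat y) false = true) := by
  rw [HARD, mem_BALL]
  constructor
  · intro h D hD
    have hlen : (List.replicate (budget (fstP^[k] (boolPair x T)).length - D.length) false ++
        true :: D).length = budget (fstP^[k] (boolPair x T)).length + 1 := by
      simp; omega
    have := (mem_EXY_iff (k := k) x T _).1 (h _ hlen)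
    rwa [decode_code] at this
  · intro h D' hD'
    have hD : (decode D').length ≤ budget (fstP^[k] (boolPair x T)).length := by
      have := length_decode_le D'; omega
    exact (mem_EXY_iff (k := k) x T D').2 (h (decode D') hD)

/-- `HARD` at core depth `1` on `⟨x, T⟩` with `|T| = 2^{|x|}` is `IsNHard |x| T`. [folklore] -/
theorem mem_HARD_one_iff {x T : List Bool} (hT : T.length = 2 ^ x.length) :
    boolPair x T ∈ HARD 1 ↔ IsNHard x.length T := by
  rw [mem_HARD_iff]
  simp only [Function.iterate_one, fstP_boolPair, IsNHard, hT, true_and]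

/-- `HARD` at core depth `2` on `⟨⟨x, T⟩, T'⟩` with `|T'| = 2^{|x|}` is `IsNHard |x| T'`. [folklore] -/
theorem mem_HARD_two_iff {x T T' : List Bool} (hT' : T'.length = 2 ^ x.length) :
    boolPair (boolPair x T) T' ∈ HARD 2 ↔ IsNHard x.length T' := by
  rw [mem_HARD_iff]
  simp only [Function.iterate_succ_apply, Function.iterate_zero_apply, fstP_boolPair, IsNHard, hT',
    true_and]

/-- Semantics of `MINL` on `⟨x, T⟩`. [folklore] -/
theorem mem_MINL_iff (x T : List Bool) :
    boolPair x T ∈ MINL ↔ ∀ T' : List Bool, T'.length = 2 ^ x.length →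
      bitsToNat T' < bitsToNat T → ¬ IsNHard x.length T' := by
  rw [MINL, mem_BALL]
  simp only [Function.iterate_one, fstP_boolPair]
  refine forall_congr' fun T' => forall_congr' fun hT' => ?_
  rw [mem_sup_iff', mem_compl_iff', mem_compl_iff', mem_HARD_two_iff hT']
  change (¬ bitsToNat (sndP _) < bitsToNat (sndP (fstP _)) ∨ _) ↔ _
  simp only [sndP_boolPair, fstP_boolPair]
  tauto

/-- Semantics of `TOPBIT`. [folklore] -/
theorem mem_TOPBIT_iff (x T : List Bool) :
    boolPair x T ∈ TOPBIT ↔ T.getD (bitsToNat x) false = true := by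
  change (sndP _).getD (bitsToNat (fstP _)) false = true ↔ _
  simp only [sndP_boolPair, fstP_boolPair]

/-- **The quantifier form of the diagonal language**: `nlang = ∃ T ∈ {0,1}^{2ⁿ} · TOP`. [folklore] -/
theorem nlang_eq_BEX_TOP : nlang = BEX 0 (fun n => 2 ^ n) TOP := by
  ext x
  rw [mem_nlang, mem_BEX]
  simp only [Function.iterate_zero_apply]
  constructor
  · rintro ⟨T, ⟨hH, hM⟩, hbit⟩
    refine ⟨T, hH.1, ?_⟩
    rw [TOP, mem_inf_iff', mem_inf_iff', mem_HARD_one_iff hH.1, mem_MINL_iff, mem_TOPBIT_iff]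
    exact ⟨⟨hH, hM⟩, hbit⟩
  · rintro ⟨T, hT, hTOP⟩
    rw [TOP, mem_inf_iff', mem_inf_iff', mem_HARD_one_iff hT, mem_MINL_iff, mem_TOPBIT_iff] at hTOP
    exact ⟨T, ⟨hTOP.1.1, hTOP.1.2⟩, hTOP.2⟩

/-! ### The matrices are polynomial-time tests -/

/-- **Bit tests at a binary address are in `P`**: for `f, g ∈ FP`, `{w | (g w)[⟦f w⟧] = 1} ∈ P`
(convert the address to unary against the ruler `g w` by `binToUnaryFn`, then read it with
`bitAtFn`). [cite: AroraBarakCC2009, §1.3] -/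
theorem setOf_getD_bitsToNat_mem_P {f g : List Bool → List Bool} (hf : f ∈ FP) (hg : g ∈ FP) :
    ({w | (g w).getD (bitsToNat (f w)) false = true} : Language Bool) ∈ Classes.P := by
  set h : List Bool → List Bool := bitAtFn ∘ fanoutFn (binToUnaryFn ∘ fanoutFn g f) g with hh
  have hhFP : h ∈ FP := comp_mem_FP bitAtFn_mem_FP
    (fanoutFn_mem_FP (comp_mem_FP binToUnaryFn_mem_FP (fanoutFn_mem_FP hg hf)) hg)
  have key : ∀ w, h w = [true] ↔ (g w).getD (bitsToNat (f w)) false = true := by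
    intro w
    simp only [hh, Function.comp, fanoutFn_apply, binToUnaryFn_boolPair, bitAtFn_boolPair,
      List.getD_eq_getElem?_getD]
    rcases lt_or_ge (bitsToNat (f w)) (g w).length with hlt | hge
    · rw [min_eq_left hlt.le]
      simp only [ones, List.length_replicate]
      rw [List.take_one_drop_eq_of_lt_length hlt, List.getElem?_eq_getElem hlt]
      simp
    · rw [min_eq_right hge]
      simp only [ones, List.length_replicate, List.drop_length, List.take_nil]
      rw [List.getElem?_eq_none hge]
      simp
  have hset : ({w | (g w).getD (bitsToNat (f w)) false = true} : Language Bool) =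
      {w | h w = (fun _ => [true]) w} := Set.ext fun w => (key w).symm
  rw [hset]
  exact setOf_apply_eq_apply_mem_P hhFP (const_mem_FP [true])

/-- `L0 ∈ P` (the circuit evaluator on `⟨y v, decode D'⟩`). [cite: AroraBarakCC2009, Thm. 6.18] -/
theorem L0_mem_P : L0 ∈ Classes.P := by
  set h : List Bool → List Bool :=
    fanoutFn (fun w => (sndP ∘ fstP) w ++ sndP w) (decode ∘ sndP ∘ fstP ∘ fstP) with hh
  have hhFP : h ∈ FP := fanoutFn_mem_FP (append_mem_FP (comp_mem_FP sndP_mem_FP fstP_mem_FP) sndP_mem_FP)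
    (comp_mem_FP decode_mem_FP (comp_mem_FP sndP_mem_FP (comp_mem_FP fstP_mem_FP fstP_mem_FP)))
  have hset : L0 = (h ⁻¹' EvalLang : Language Bool) := by
    ext w
    change descAccepts _ _ = true ↔ evalFn (h w) = [true]
    simp [hh, descAccepts, Function.comp]
  rw [hset]
  exact preimage_mem_P EvalLang_mem_P hhFP

/-- `BIT ∈ P`. [cite: AroraBarakCC2009, §1.3] -/
theorem BIT_mem_P : BIT ∈ Classes.P :=
  setOf_getD_bitsToNat_mem_P sndP_mem_FP (comp_mem_FP sndP_mem_FP (comp_mem_FP fstP_mem_FP fstP_mem_FP))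

/-- `TOPBIT ∈ P`. [cite: AroraBarakCC2009, §1.3] -/
theorem TOPBIT_mem_P : TOPBIT ∈ Classes.P :=
  setOf_getD_bitsToNat_mem_P fstP_mem_FP sndP_mem_FP

/-- `LT ∈ P` (binary comparison `Brick.ltFn`). [cite: AroraBarakCC2009, §1.3] -/
theorem LT_mem_P : LT ∈ Classes.P := by
  have hset : LT = ({u | (Brick.ltFn ∘ fanoutFn sndP (sndP ∘ fstP)) u = (fun _ => [true]) u} : Language Bool) := by
    ext u
    change bitsToNat (sndP u) < bitsToNat (sndP (fstP u)) ↔ (Brick.ltFn ∘ fanoutFn sndP (sndP ∘ fstP)) u = [true]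
    simp [Function.comp, fanoutFn_apply]
  rw [hset]
  exact setOf_apply_eq_apply_mem_P (comp_mem_FP Brick.ltFn_mem_FP
    (fanoutFn_mem_FP sndP_mem_FP (comp_mem_FP sndP_mem_FP fstP_mem_FP))) (const_mem_FP [true])

end NKannan

end Literature.Computability.Complexity
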